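import Summits.ABC.IUTFork.Cor312GenuineKWildExactDecided
import Literature.IUT.LogVolume.DifferentOrdHenselBound
import HarnessLib

/-!
# [IUTchIII] Cor. 3.12, branch C / R-W window table — the WILD different at the `K`-level pilot datum, UPPER side:
# at every fibre point `x₀ ∣ p ∈ {3, 5}` (`p ≠ l`) over a pole of `j`, `v_p(e) ≤ 1`, hence `d(K_{x₀}) ≤ 2 − 1/e` (Hensel);
# at a W1 pole (`p ∤ t`) the different is EXACT: `d(K_{x₀}) = (2e − 1)/e`, `ord_u 𝔇_{K/ℤ} = 2e − 1`

PROOF-ONLY support file (D-0012; 0 definitions, 0 `Prop` facts) of the abc-iut cell (R-W «WINDOW Θ-SIDE INEQUALITY», seat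
abc-iut-w5-d180 gen 10, row «W:HENSEL-DIFFERENT-LOCAL»; GAP G-Wnum2-1 (ii) REFUTED side / D-G-Wnum2-1 route (R1)). TAKES NO SIDE
on [IUTchIII] Cor. 3.12 (S. Mochizuki, *Inter-universal Teichmüller theory III*, Cor. 3.12 p. 173–174) or on any author.

Inputs BY NAME: abc-iut-W-neg-1's EXACT wild local types at a rational-point genuine Θ-volume datum
(`GenuineK.absRamificationIdx_kOf_eq_wild_ratPoint` — W1, `p ∤ t`: `e = p(p−1)·r·l`; `GenuineK.absRamificationIdx_kOf_eq_wild_ite_ratPoint`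
— `p ∣ t`: `e ∈ {p(p−1)·r·l, (p−1)·r·l}`; `r = p′/gcd(p′,t)`, `{p,p′} = {3,5}`), its LOWER different bound at W1 poles
(`GenuineK.sub_one_div_le_differentOrd_kOf_wild_ratPoint`: `(2e−1)/e ≤ d`), and this seat's local Hensel bound
`Literature.IUT.LogVolume.differentOrd_rescaledCompletion_le` (`d(K_w) ≤ 1 − 1/e + v_p(e)` at every genuine completion,
`DifferentOrdHenselBound.lean`). For `T : Cor22.ThetaVolumeDatumAt (ratPoint q₀) l`, `p ∈ {3,5}`, `p ≠ l`, a pole of `j(q₀)` of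
order `2t > 0` at `p`, and EVERY fibre point `x₀ ∣ p` of the pilot datum (`K_{x₀} = kOf … x₀`):

* §1 `GenuineK.padicValNat_absRamificationIdx_kOf_le_one_ratPoint` — **`v_p(e(K_{x₀}/ℚ_p)) ≤ 1`** (the cofactor `(p−1)·r·l` is
  prime to `p`); `GenuineK.absRamificationIdx_kOf_le_wild_ratPoint` — `e ≤ p(p−1)·p′·l` (`= 30·l` at `p = 3`, `60·l` at `p = 5`).
* §2 **`GenuineK.differentOrd_kOf_le_two_sub_inv_ratPoint`** — `d(K_{x₀}) ≤ 2 − 1/e`, i.e. `ord 𝔇 ≤ 2e − 1`, at EVERY wild or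
  tame pole type (W1, W2, split);
  **`GenuineK.differentOrd_kOf_eq_wild_ratPoint`** — at a W1 pole (`p ∤ t`): `d(K_{x₀}) = (2e − 1)/e` EXACTLY, and the global
  **`GenuineK.multiplicity_differentIdeal_placeOf_eq_wild_ratPoint`** — `ord_u 𝔇_{K/ℤ} = 2·e(u|p) − 1` at `u = placeOf x₀`
  (the N1-WILD-EXACT value `δ_w = 2e_w − 1` of the cell's W-num-2 desk table, now a kernel equality).
* §3 `GenuineK.depthConstants_kOf_le_wild_ratPoint_of_lt_pow` — `e < p^B·(p−1) ⇒ d + a + b ≤ B + 2 + 1/(p−2) − 1/e` and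
  **`GenuineK.depthConstants_kOf_le_wild_ratPoint`** — `p·p′·l < p^B ⇒ d + a + b ≤ B + 2 + 1/(p−2) − 1/e`: the [IUTchIV] Prop. 1.2
  budget at the wild pole primes, uniform in the local type (the tame socket bound `depthConstants_le_of_not_dvd_of_lt_pow`
  reads `B + 1 + 1/(p−2) − 1/e`; the wild term `v_p(e) ≤ 1` costs exactly `1`).

HONEST FRAMING: bookkeeping over OUR typed objects (classical Tate-curve, local and global number-field theory); nothing here bears
on the printed inequality of [IUTchIII] Cor. 3.12 or on the number-level `Cor22.Cor312AtDatum`; typed ≠ proved; instantiated ≠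
endorsed; no abc claim. [cite: SerreLocalFields1979, Ch. III §4 Prop. 10, §6 Prop. 13 and Remark] [cite: NeukirchANT1999, Ch. III (2.6)]
[cite: Mochizuki2012, IUTchIV Prop. 1.2 p. 10, Thm. 1.10 p. 22] [claim: Mochizuki2012, status: disputed] for every IUT quotation.
-/

noncomputable section

open NumberField IsDedekindDomain

namespace Summit.ABC.IUTFork.Conditional

open Thm311 Thm311.Real Cor312 Cor312Prov Literature.IUT.LogVolume Literature.IUT.HodgeTheaters
  Literature.IUT.LogThetaLattice Literature.NumberTheory.NumberFields Literature.NumberTheory.DiophantineGeometry.GenEll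
  Literature.NumberTheory.DiophantineGeometry

/-! ## §1. `v_p(e) ≤ 1` and `e ≤ p(p−1)·p′·l` at every fibre point over a pole `p ∈ {3, 5}` -/

/-- **`v_p(e(K_{x₀}/ℚ_p)) ≤ 1` at every fibre point over a pole `p ∈ {3,5}`, `p ≠ l`** (pole order `2t > 0`): by abc-iut-W-neg-1's
exact local types `e = p(p−1)·r·l` (W1/W2) or `(p−1)·r·l` (split), `r = p′/gcd(p′,t)`, whose cofactor `(p−1)·r·l` is prime to `p`.
[cite: Mochizuki2012, IUTchI Ex. 3.2 (iv) p. 71; IUTchIV Thm. 1.10 p. 22] [claim: Mochizuki2012, status: disputed] -/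
theorem GenuineK.padicValNat_absRamificationIdx_kOf_le_one_ratPoint {q₀ : ℚ} {l : ℕ}
    (T : Cor22.ThetaVolumeDatumAt (ratPoint q₀) l)
    (pp : Nat.Primes) {p' : ℕ} (hpq : ((pp : ℕ) = 3 ∧ p' = 5) ∨ ((pp : ℕ) = 5 ∧ p' = 3)) (hpl : (pp : ℕ) ≠ l)
    {t : ℕ} (ht : 0 < t)
    (hpole : ∀ v : HeightOneSpectrum (𝓞 ℚ), Rat.HeightOneSpectrum.natGenerator v = pp →
      Literature.IUT.LogVolume.ord ℚ v (Cor22.jInv q₀) = -(2 * (t : ℤ))) :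
    letI := T.instFieldF; letI := T.instNumberFieldF; letI := T.instAlgebraF; letI := T.instFieldK
    letI := T.instNumberFieldK; letI := T.instAlgebraK; letI := T.instFieldFbar; letI := T.instAlgebraFbar
    letI := T.instAlgebraKFbar; letI := T.instIsElliptic
    haveI : Fact (pp : ℕ).Prime := ⟨pp.2⟩
    ∀ x₀ : (thetaIndex (pilotDataOfK T.D T.K)).Fibre (.inr pp),
      padicValNat pp (absRamificationIdx (pp : ℕ) (kOf (pilotDataOfK T.D T.K) pp.1 x₀)) ≤ 1 := by
  letI := T.instFieldF; letI := T.instNumberFieldF; letI := T.instAlgebraF; letI := T.instFieldK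
  letI := T.instNumberFieldK; letI := T.instAlgebraK; letI := T.instFieldFbar; letI := T.instAlgebraFbar
  letI := T.instAlgebraKFbar; letI := T.instIsElliptic
  haveI : Fact (pp : ℕ).Prime := ⟨pp.2⟩
  have hp : (pp : ℕ).Prime := pp.2
  have h2 : 2 ≤ (pp : ℕ) := hp.two_le
  intro x₀
  -- the cofactor `(p−1)·r·l` is prime to `p`
  have hr : (p' / Nat.gcd p' t) ∣ p' := Nat.div_dvd_of_dvd (Nat.gcd_dvd_left p' t)
  have hpp' : ¬ (pp : ℕ) ∣ p' := by
    rcases hpq with ⟨h3, h5⟩ | ⟨h5, h3⟩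
    · rw [h3, h5]; norm_num
    · rw [h5, h3]; norm_num
  have hcop : ¬ (pp : ℕ) ∣ ((pp : ℕ) - 1) * (p' / Nat.gcd p' t) * l := by
    intro h
    rcases (Nat.Prime.dvd_mul hp).mp h with h | h
    · rcases (Nat.Prime.dvd_mul hp).mp h with h | h
      · exact Nat.not_dvd_of_pos_of_lt (by omega) (by omega) h
      · exact hpp' (h.trans hr)
    · exact hpl ((Nat.prime_dvd_prime_iff_eq hp T.D.l_prime).mp h)
  have hcof0 : ((pp : ℕ) - 1) * (p' / Nat.gcd p' t) * l ≠ 0 := by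
    intro h0; rw [h0] at hcop; exact hcop (dvd_zero _)
  have hval1 : padicValNat pp ((pp : ℕ) * (((pp : ℕ) - 1) * (p' / Nat.gcd p' t) * l)) = 1 := by
    rw [padicValNat.mul hp.ne_zero hcof0, padicValNat_self, padicValNat.eq_zero_of_not_dvd hcop]
  have hassoc : (pp : ℕ) * ((pp : ℕ) - 1) * (p' / Nat.gcd p' t) * l =
      (pp : ℕ) * (((pp : ℕ) - 1) * (p' / Nat.gcd p' t) * l) := by ring
  by_cases hpt : (pp : ℕ) ∣ t
  · rw [GenuineK.absRamificationIdx_kOf_eq_wild_ite_ratPoint T pp hpq hpl ht hpt hpole x₀]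
    split_ifs with h1
    · rw [hassoc, hval1]
    · rw [padicValNat.eq_zero_of_not_dvd hcop]; exact zero_le_one
  · rw [GenuineK.absRamificationIdx_kOf_eq_wild_ratPoint T pp hpq hpl ht hpt hpole x₀, hassoc, hval1]

/-- **`e(K_{x₀}/ℚ_p) ≤ p(p−1)·p′·l`** at every fibre point over a pole `p ∈ {3,5}`, `p ≠ l` (`= 30·l` at `p = 3`, `= 60·l` at
`p = 5`): the exact local type is `c·(p′/gcd(p′,t))·l` with `c ∈ {p(p−1), p−1}`.
[cite: Mochizuki2012, IUTchI Ex. 3.2 (iv) p. 71; IUTchIV Thm. 1.10 p. 22] [claim: Mochizuki2012, status: disputed] -/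
theorem GenuineK.absRamificationIdx_kOf_le_wild_ratPoint {q₀ : ℚ} {l : ℕ}
    (T : Cor22.ThetaVolumeDatumAt (ratPoint q₀) l)
    (pp : Nat.Primes) {p' : ℕ} (hpq : ((pp : ℕ) = 3 ∧ p' = 5) ∨ ((pp : ℕ) = 5 ∧ p' = 3)) (hpl : (pp : ℕ) ≠ l)
    {t : ℕ} (ht : 0 < t)
    (hpole : ∀ v : HeightOneSpectrum (𝓞 ℚ), Rat.HeightOneSpectrum.natGenerator v = pp →
      Literature.IUT.LogVolume.ord ℚ v (Cor22.jInv q₀) = -(2 * (t : ℤ))) :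
    letI := T.instFieldF; letI := T.instNumberFieldF; letI := T.instAlgebraF; letI := T.instFieldK
    letI := T.instNumberFieldK; letI := T.instAlgebraK; letI := T.instFieldFbar; letI := T.instAlgebraFbar
    letI := T.instAlgebraKFbar; letI := T.instIsElliptic
    haveI : Fact (pp : ℕ).Prime := ⟨pp.2⟩
    ∀ x₀ : (thetaIndex (pilotDataOfK T.D T.K)).Fibre (.inr pp),
      absRamificationIdx (pp : ℕ) (kOf (pilotDataOfK T.D T.K) pp.1 x₀) ≤ (pp : ℕ) * ((pp : ℕ) - 1) * p' * l := by
  letI := T.instFieldF; letI := T.instNumberFieldF; letI := T.instAlgebraF; letI := T.instFieldK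
  letI := T.instNumberFieldK; letI := T.instAlgebraK; letI := T.instFieldFbar; letI := T.instAlgebraFbar
  letI := T.instAlgebraKFbar; letI := T.instIsElliptic
  haveI : Fact (pp : ℕ).Prime := ⟨pp.2⟩
  have hp : (pp : ℕ).Prime := pp.2
  have h2 : 2 ≤ (pp : ℕ) := hp.two_le
  intro x₀
  have hp'0 : 0 < p' := by rcases hpq with ⟨-, h⟩ | ⟨-, h⟩ <;> omega
  have hr : p' / Nat.gcd p' t ≤ p' := Nat.div_le_self _ _
  have hmono : ∀ c : ℕ, c ≤ (pp : ℕ) * ((pp : ℕ) - 1) → c * (p' / Nat.gcd p' t) * l ≤ (pp : ℕ) * ((pp : ℕ) - 1) * p' * l :=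
    fun c hc => Nat.mul_le_mul (Nat.mul_le_mul hc hr) le_rfl
  by_cases hpt : (pp : ℕ) ∣ t
  · rw [GenuineK.absRamificationIdx_kOf_eq_wild_ite_ratPoint T pp hpq hpl ht hpt hpole x₀]
    split_ifs with h1
    · exact hmono _ le_rfl
    · refine hmono _ ?_
      calc (pp : ℕ) - 1 = 1 * ((pp : ℕ) - 1) := (one_mul _).symm
        _ ≤ (pp : ℕ) * ((pp : ℕ) - 1) := Nat.mul_le_mul_right _ (by omega)
  · rw [GenuineK.absRamificationIdx_kOf_eq_wild_ratPoint T pp hpq hpl ht hpt hpole x₀]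
    exact hmono _ le_rfl

/-! ## §2. The different: `d ≤ 2 − 1/e` at every pole type; `d = (2e − 1)/e` exactly at W1 poles -/

/-- **Hensel at the wild pole primes: `d(K_{x₀}) ≤ 2 − 1/e(K_{x₀}/ℚ_p)`** at every fibre point over a pole `p ∈ {3,5}`, `p ≠ l`
(pole order `2t > 0`; ANY type W1/W2/split): this seat's `differentOrd_rescaledCompletion_le_two_sub_inv` (`d ≤ 1 − 1/e + v_p(e)`,
Dedekind–Hensel through the local–global bridge) with §1's `v_p(e) ≤ 1`.
[cite: SerreLocalFields1979, Ch. III §6 Prop. 13 and Remark] [cite: Mochizuki2012, IUTchIV Thm. 1.10 p. 22] [claim: Mochizuki2012, status: disputed] -/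
theorem GenuineK.differentOrd_kOf_le_two_sub_inv_ratPoint {q₀ : ℚ} {l : ℕ}
    (T : Cor22.ThetaVolumeDatumAt (ratPoint q₀) l)
    (pp : Nat.Primes) {p' : ℕ} (hpq : ((pp : ℕ) = 3 ∧ p' = 5) ∨ ((pp : ℕ) = 5 ∧ p' = 3)) (hpl : (pp : ℕ) ≠ l)
    {t : ℕ} (ht : 0 < t)
    (hpole : ∀ v : HeightOneSpectrum (𝓞 ℚ), Rat.HeightOneSpectrum.natGenerator v = pp →
      Literature.IUT.LogVolume.ord ℚ v (Cor22.jInv q₀) = -(2 * (t : ℤ))) :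
    letI := T.instFieldF; letI := T.instNumberFieldF; letI := T.instAlgebraF; letI := T.instFieldK
    letI := T.instNumberFieldK; letI := T.instAlgebraK; letI := T.instFieldFbar; letI := T.instAlgebraFbar
    letI := T.instAlgebraKFbar; letI := T.instIsElliptic
    haveI : Fact (pp : ℕ).Prime := ⟨pp.2⟩
    ∀ x₀ : (thetaIndex (pilotDataOfK T.D T.K)).Fibre (.inr pp),
      differentOrd (pp : ℕ) (kOf (pilotDataOfK T.D T.K) pp.1 x₀) ≤
        2 - 1 / (absRamificationIdx (pp : ℕ) (kOf (pilotDataOfK T.D T.K) pp.1 x₀) : ℝ) := by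
  letI := T.instFieldF; letI := T.instNumberFieldF; letI := T.instAlgebraF; letI := T.instFieldK
  letI := T.instNumberFieldK; letI := T.instAlgebraK; letI := T.instFieldFbar; letI := T.instAlgebraFbar
  letI := T.instAlgebraKFbar; letI := T.instIsElliptic
  haveI : Fact (pp : ℕ).Prime := ⟨pp.2⟩
  set X := pilotDataOfK T.D T.K with hXdef
  intro x₀
  have hpu : ((pp : ℕ) : 𝓞 T.K) ∈ (placeOf X pp.1 x₀).asIdeal := natCast_mem_placeOf X pp.1 x₀
  have hv := GenuineK.padicValNat_absRamificationIdx_kOf_le_one_ratPoint T pp hpq hpl ht hpole x₀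
  have hv' : padicValNat pp (absRamificationIdx (pp : ℕ) (RescaledCompletion T.K pp.1 (placeOf X pp.1 x₀) hpu)) ≤ 1 := hv
  have h := differentOrd_rescaledCompletion_le_two_sub_inv T.K (pp : ℕ) (placeOf X pp.1 x₀) hpu hv'
  exact h

/-- **THE WILD DIFFERENT AT A W1 POLE, EXACT: `d(K_{x₀}) = (2e − 1)/e`** at every fibre point over a pole `p ∈ {3,5}`, `p ≠ l`, of
order `2t` with `p ∤ t`: abc-iut-W-neg-1's Eisenstein-radical lower bound `(2e−1)/e ≤ d` (`GenuineK.sub_one_div_le_differentOrd_kOf_wild_ratPoint`)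
meets Hensel's upper bound `d ≤ 2 − 1/e`. (The cell's desk value `δ_w = 2e_w − 1` of N1-WILD-EXACT, GAP G-Wnum2-1 (ii), both sides
now in the kernel.) [cite: SerreLocalFields1979, Ch. III §6 Prop. 13 and Remark] [cite: Mochizuki2012, IUTchIV Thm. 1.10 p. 22]
[claim: Mochizuki2012, status: disputed] -/
theorem GenuineK.differentOrd_kOf_eq_wild_ratPoint {q₀ : ℚ} {l : ℕ}
    (T : Cor22.ThetaVolumeDatumAt (ratPoint q₀) l)
    (pp : Nat.Primes) {p' : ℕ} (hpq : ((pp : ℕ) = 3 ∧ p' = 5) ∨ ((pp : ℕ) = 5 ∧ p' = 3)) (hpl : (pp : ℕ) ≠ l)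
    {t : ℕ} (ht : 0 < t) (hpt : ¬ (pp : ℕ) ∣ t)
    (hpole : ∀ v : HeightOneSpectrum (𝓞 ℚ), Rat.HeightOneSpectrum.natGenerator v = pp →
      Literature.IUT.LogVolume.ord ℚ v (Cor22.jInv q₀) = -(2 * (t : ℤ))) :
    letI := T.instFieldF; letI := T.instNumberFieldF; letI := T.instAlgebraF; letI := T.instFieldK
    letI := T.instNumberFieldK; letI := T.instAlgebraK; letI := T.instFieldFbar; letI := T.instAlgebraFbar
    letI := T.instAlgebraKFbar; letI := T.instIsElliptic
    haveI : Fact (pp : ℕ).Prime := ⟨pp.2⟩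
    ∀ x₀ : (thetaIndex (pilotDataOfK T.D T.K)).Fibre (.inr pp),
      differentOrd (pp : ℕ) (kOf (pilotDataOfK T.D T.K) pp.1 x₀) =
        ((2 * absRamificationIdx (pp : ℕ) (kOf (pilotDataOfK T.D T.K) pp.1 x₀) - 1 : ℕ) : ℝ) /
          (absRamificationIdx (pp : ℕ) (kOf (pilotDataOfK T.D T.K) pp.1 x₀) : ℝ) := by
  letI := T.instFieldF; letI := T.instNumberFieldF; letI := T.instAlgebraF; letI := T.instFieldK
  letI := T.instNumberFieldK; letI := T.instAlgebraK; letI := T.instFieldFbar; letI := T.instAlgebraFbar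
  letI := T.instAlgebraKFbar; letI := T.instIsElliptic
  haveI : Fact (pp : ℕ).Prime := ⟨pp.2⟩
  have hp30 : (pp : ℕ) ∣ 30 := by rcases hpq with ⟨h, -⟩ | ⟨h, -⟩ <;> rw [h] <;> norm_num
  have hp2 : (pp : ℕ) ≠ 2 := by rcases hpq with ⟨h, -⟩ | ⟨h, -⟩ <;> omega
  intro x₀
  have hlo := GenuineK.sub_one_div_le_differentOrd_kOf_wild_ratPoint T pp hp30 hp2 ht hpt hpole x₀
  have hhi := GenuineK.differentOrd_kOf_le_two_sub_inv_ratPoint T pp hpq hpl ht hpole x₀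
  have he := absRamificationIdx_pos (pp : ℕ) (kOf (pilotDataOfK T.D T.K) pp.1 x₀)
  have he' : (0 : ℝ) < (absRamificationIdx (pp : ℕ) (kOf (pilotDataOfK T.D T.K) pp.1 x₀) : ℝ) := by exact_mod_cast he
  have hcast : ((2 * absRamificationIdx (pp : ℕ) (kOf (pilotDataOfK T.D T.K) pp.1 x₀) - 1 : ℕ) : ℝ) =
      2 * (absRamificationIdx (pp : ℕ) (kOf (pilotDataOfK T.D T.K) pp.1 x₀) : ℝ) - 1 := by
    rw [Nat.cast_sub (by omega), Nat.cast_mul]; norm_num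
  have hid : ((2 * absRamificationIdx (pp : ℕ) (kOf (pilotDataOfK T.D T.K) pp.1 x₀) - 1 : ℕ) : ℝ) /
      (absRamificationIdx (pp : ℕ) (kOf (pilotDataOfK T.D T.K) pp.1 x₀) : ℝ) =
      2 - 1 / (absRamificationIdx (pp : ℕ) (kOf (pilotDataOfK T.D T.K) pp.1 x₀) : ℝ) := by
    rw [hcast]; field_simp
  rw [hid] at hlo ⊢
  exact le_antisymm hhi hlo

/-- **Global form, EXACT: `ord_u 𝔇_{K/ℤ} = 2·e(u|p) − 1`** at the place `u = placeOf x₀` under every fibre point over a W1 pole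
(`p ∈ {3,5}`, `p ≠ l`, `p ∤ t`): abc-iut-W-neg-1's `2e − 1 ≤ ord_u 𝔇` and this seat's `ord_u 𝔇 + 1 ≤ 2e`
(`multiplicity_differentIdeal_int_succ_le_two_mul`, `v_p(e) ≤ 1`). [cite: SerreLocalFields1979, Ch. III §4 Prop. 10, §6 Prop. 13 and Remark]
[cite: Mochizuki2012, IUTchIV Thm. 1.10 p. 22] [claim: Mochizuki2012, status: disputed] -/
theorem GenuineK.multiplicity_differentIdeal_placeOf_eq_wild_ratPoint {q₀ : ℚ} {l : ℕ}
    (T : Cor22.ThetaVolumeDatumAt (ratPoint q₀) l)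
    (pp : Nat.Primes) {p' : ℕ} (hpq : ((pp : ℕ) = 3 ∧ p' = 5) ∨ ((pp : ℕ) = 5 ∧ p' = 3)) (hpl : (pp : ℕ) ≠ l)
    {t : ℕ} (ht : 0 < t) (hpt : ¬ (pp : ℕ) ∣ t)
    (hpole : ∀ v : HeightOneSpectrum (𝓞 ℚ), Rat.HeightOneSpectrum.natGenerator v = pp →
      Literature.IUT.LogVolume.ord ℚ v (Cor22.jInv q₀) = -(2 * (t : ℤ))) :
    letI := T.instFieldF; letI := T.instNumberFieldF; letI := T.instAlgebraF; letI := T.instFieldK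
    letI := T.instNumberFieldK; letI := T.instAlgebraK; letI := T.instFieldFbar; letI := T.instAlgebraFbar
    letI := T.instAlgebraKFbar; letI := T.instIsElliptic
    haveI : Fact (pp : ℕ).Prime := ⟨pp.2⟩
    ∀ x₀ : (thetaIndex (pilotDataOfK T.D T.K)).Fibre (.inr pp),
      multiplicity (placeOf (pilotDataOfK T.D T.K) pp.1 x₀).asIdeal (differentIdeal ℤ (𝓞 T.K)) =
        2 * (placeOf (pilotDataOfK T.D T.K) pp.1 x₀).asIdeal.ramificationIdx ℤ - 1 := by
  letI := T.instFieldF; letI := T.instNumberFieldF; letI := T.instAlgebraF; letI := T.instFieldK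
  letI := T.instNumberFieldK; letI := T.instAlgebraK; letI := T.instFieldFbar; letI := T.instAlgebraFbar
  letI := T.instAlgebraKFbar; letI := T.instIsElliptic
  haveI : Fact (pp : ℕ).Prime := ⟨pp.2⟩
  have hp30 : (pp : ℕ) ∣ 30 := by rcases hpq with ⟨h, -⟩ | ⟨h, -⟩ <;> rw [h] <;> norm_num
  have hp2 : (pp : ℕ) ≠ 2 := by rcases hpq with ⟨h, -⟩ | ⟨h, -⟩ <;> omega
  set X := pilotDataOfK T.D T.K with hXdef
  intro x₀
  set u := placeOf X pp.1 x₀ with hudef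
  have hpu : ((pp : ℕ) : 𝓞 T.K) ∈ u.asIdeal := natCast_mem_placeOf X pp.1 x₀
  have hlo := GenuineK.sub_one_le_multiplicity_differentIdeal_placeOf_wild_ratPoint T pp hp30 hp2 ht hpt hpole x₀
  have hv := GenuineK.padicValNat_absRamificationIdx_kOf_le_one_ratPoint T pp hpq hpl ht hpole x₀
  have he : absRamificationIdx (pp : ℕ) (kOf X pp.1 x₀) = u.asIdeal.ramificationIdx ℤ := by
    rw [show absRamificationIdx (pp : ℕ) (kOf X pp.1 x₀) =
        absRamificationIdx (pp : ℕ) (RescaledCompletion T.K pp.1 (placeOf X pp.1 x₀) hpu) from rfl,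
      absRamificationIdx_rescaledCompletion]
  rw [he] at hv
  have hhi := multiplicity_differentIdeal_int_succ_le_two_mul T.K (pp : ℕ) u hpu hv
  have hlo' : 2 * u.asIdeal.ramificationIdx ℤ - 1 ≤ multiplicity u.asIdeal (differentIdeal ℤ (𝓞 T.K)) := hlo
  omega

/-! ## §3. The [IUTchIV] Prop. 1.2 budget `d + a + b` at the wild pole primes, uniform in the local type -/

/-- **`e < p^B·(p−1) ⇒ d + a + b ≤ B + 2 + 1/(p−2) − 1/e`** at every fibre point over a pole `p ∈ {3,5}`, `p ≠ l` (`2t > 0`, ANY type):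
this seat's wild budget `depthConstants_rescaledCompletion_le_of_lt_pow` (`≤ B + 1 + 1/(p−2) − 1/e + v_p(e)`) with §1's `v_p(e) ≤ 1`.
[cite: Mochizuki2012, IUTchIV Prop. 1.2 p. 10] [cite: SerreLocalFields1979, Ch. III §6 Prop. 13 and Remark] [claim: Mochizuki2012, status: disputed] -/
theorem GenuineK.depthConstants_kOf_le_wild_ratPoint_of_lt_pow {q₀ : ℚ} {l : ℕ}
    (T : Cor22.ThetaVolumeDatumAt (ratPoint q₀) l)
    (pp : Nat.Primes) {p' : ℕ} (hpq : ((pp : ℕ) = 3 ∧ p' = 5) ∨ ((pp : ℕ) = 5 ∧ p' = 3)) (hpl : (pp : ℕ) ≠ l)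
    {t : ℕ} (ht : 0 < t)
    (hpole : ∀ v : HeightOneSpectrum (𝓞 ℚ), Rat.HeightOneSpectrum.natGenerator v = pp →
      Literature.IUT.LogVolume.ord ℚ v (Cor22.jInv q₀) = -(2 * (t : ℤ))) (B : ℕ) :
    letI := T.instFieldF; letI := T.instNumberFieldF; letI := T.instAlgebraF; letI := T.instFieldK
    letI := T.instNumberFieldK; letI := T.instAlgebraK; letI := T.instFieldFbar; letI := T.instAlgebraFbar
    letI := T.instAlgebraKFbar; letI := T.instIsElliptic
    haveI : Fact (pp : ℕ).Prime := ⟨pp.2⟩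
    ∀ x₀ : (thetaIndex (pilotDataOfK T.D T.K)).Fibre (.inr pp),
      absRamificationIdx (pp : ℕ) (kOf (pilotDataOfK T.D T.K) pp.1 x₀) < (pp : ℕ) ^ B * ((pp : ℕ) - 1) →
      differentOrd (pp : ℕ) (kOf (pilotDataOfK T.D T.K) pp.1 x₀)
        + logRadiusA (pp : ℕ) (absRamificationIdx (pp : ℕ) (kOf (pilotDataOfK T.D T.K) pp.1 x₀))
        + logRadiusB (pp : ℕ) (absRamificationIdx (pp : ℕ) (kOf (pilotDataOfK T.D T.K) pp.1 x₀)) ≤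
        (B : ℝ) + 2 + 1 / (((pp : ℕ) : ℝ) - 2) - 1 / (absRamificationIdx (pp : ℕ) (kOf (pilotDataOfK T.D T.K) pp.1 x₀) : ℝ) := by
  letI := T.instFieldF; letI := T.instNumberFieldF; letI := T.instAlgebraF; letI := T.instFieldK
  letI := T.instNumberFieldK; letI := T.instAlgebraK; letI := T.instFieldFbar; letI := T.instAlgebraFbar
  letI := T.instAlgebraKFbar; letI := T.instIsElliptic
  haveI : Fact (pp : ℕ).Prime := ⟨pp.2⟩
  have hp2' : 2 < (pp : ℕ) := by rcases hpq with ⟨h, -⟩ | ⟨h, -⟩ <;> omega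
  set X := pilotDataOfK T.D T.K with hXdef
  intro x₀ hlt
  have hpu : ((pp : ℕ) : 𝓞 T.K) ∈ (placeOf X pp.1 x₀).asIdeal := natCast_mem_placeOf X pp.1 x₀
  have hv := GenuineK.padicValNat_absRamificationIdx_kOf_le_one_ratPoint T pp hpq hpl ht hpole x₀
  have hv' : (padicValNat pp (absRamificationIdx (pp : ℕ) (kOf X pp.1 x₀)) : ℝ) ≤ 1 := by exact_mod_cast hv
  have hlt' : absRamificationIdx (pp : ℕ) (RescaledCompletion T.K pp.1 (placeOf X pp.1 x₀) hpu) <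
      (pp : ℕ) ^ B * ((pp : ℕ) - 1) := hlt
  have h := depthConstants_rescaledCompletion_le_of_lt_pow T.K (pp : ℕ) (placeOf X pp.1 x₀) hpu hp2' hlt'
  have h' : differentOrd (pp : ℕ) (kOf X pp.1 x₀)
      + logRadiusA (pp : ℕ) (absRamificationIdx (pp : ℕ) (kOf X pp.1 x₀))
      + logRadiusB (pp : ℕ) (absRamificationIdx (pp : ℕ) (kOf X pp.1 x₀)) ≤
      (B : ℝ) + 1 + 1 / (((pp : ℕ) : ℝ) - 2) - 1 / (absRamificationIdx (pp : ℕ) (kOf X pp.1 x₀) : ℝ)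
        + padicValNat (pp : ℕ) (absRamificationIdx (pp : ℕ) (kOf X pp.1 x₀)) := h
  linarith

/-- **`p·p′·l < p^B ⇒ d + a + b ≤ B + 2 + 1/(p−2) − 1/e` at EVERY fibre point over a pole `p ∈ {3,5}`, `p ≠ l`** (`{p,p′} = {3,5}`,
pole order `2t > 0`; e.g. `B = 5` at `p = 3` for `l ≤ 16`, `B = 6` for `l ≤ 48`): the ramification bound `e ≤ p(p−1)·p′·l` (§1) feeds
the previous budget — NO hypothesis on the local type. The wild analogue of the tame socket bound `depthConstants_le_of_not_dvd_of_lt_pow`.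
[cite: Mochizuki2012, IUTchIV Prop. 1.2 p. 10] [cite: SerreLocalFields1979, Ch. III §6 Prop. 13 and Remark] [claim: Mochizuki2012, status: disputed] -/
theorem GenuineK.depthConstants_kOf_le_wild_ratPoint {q₀ : ℚ} {l : ℕ}
    (T : Cor22.ThetaVolumeDatumAt (ratPoint q₀) l)
    (pp : Nat.Primes) {p' : ℕ} (hpq : ((pp : ℕ) = 3 ∧ p' = 5) ∨ ((pp : ℕ) = 5 ∧ p' = 3)) (hpl : (pp : ℕ) ≠ l)
    {t : ℕ} (ht : 0 < t)
    (hpole : ∀ v : HeightOneSpectrum (𝓞 ℚ), Rat.HeightOneSpectrum.natGenerator v = pp →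
      Literature.IUT.LogVolume.ord ℚ v (Cor22.jInv q₀) = -(2 * (t : ℤ))) {B : ℕ} (hB : (pp : ℕ) * p' * l < (pp : ℕ) ^ B) :
    letI := T.instFieldF; letI := T.instNumberFieldF; letI := T.instAlgebraF; letI := T.instFieldK
    letI := T.instNumberFieldK; letI := T.instAlgebraK; letI := T.instFieldFbar; letI := T.instAlgebraFbar
    letI := T.instAlgebraKFbar; letI := T.instIsElliptic
    haveI : Fact (pp : ℕ).Prime := ⟨pp.2⟩
    ∀ x₀ : (thetaIndex (pilotDataOfK T.D T.K)).Fibre (.inr pp),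
      differentOrd (pp : ℕ) (kOf (pilotDataOfK T.D T.K) pp.1 x₀)
        + logRadiusA (pp : ℕ) (absRamificationIdx (pp : ℕ) (kOf (pilotDataOfK T.D T.K) pp.1 x₀))
        + logRadiusB (pp : ℕ) (absRamificationIdx (pp : ℕ) (kOf (pilotDataOfK T.D T.K) pp.1 x₀)) ≤
        (B : ℝ) + 2 + 1 / (((pp : ℕ) : ℝ) - 2) - 1 / (absRamificationIdx (pp : ℕ) (kOf (pilotDataOfK T.D T.K) pp.1 x₀) : ℝ) := by
  letI := T.instFieldF; letI := T.instNumberFieldF; letI := T.instAlgebraF; letI := T.instFieldK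
  letI := T.instNumberFieldK; letI := T.instAlgebraK; letI := T.instFieldFbar; letI := T.instAlgebraFbar
  letI := T.instAlgebraKFbar; letI := T.instIsElliptic
  haveI : Fact (pp : ℕ).Prime := ⟨pp.2⟩
  have h2 : 2 ≤ (pp : ℕ) := pp.2.two_le
  intro x₀
  have hle := GenuineK.absRamificationIdx_kOf_le_wild_ratPoint T pp hpq hpl ht hpole x₀
  have hlt : absRamificationIdx (pp : ℕ) (kOf (pilotDataOfK T.D T.K) pp.1 x₀) < (pp : ℕ) ^ B * ((pp : ℕ) - 1) := by
    have h1 : (pp : ℕ) * ((pp : ℕ) - 1) * p' * l = ((pp : ℕ) * p' * l) * ((pp : ℕ) - 1) := by ring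
    have h3 : ((pp : ℕ) * p' * l) * ((pp : ℕ) - 1) < (pp : ℕ) ^ B * ((pp : ℕ) - 1) :=
      Nat.mul_lt_mul_of_pos_right hB (by omega)
    omega
  exact GenuineK.depthConstants_kOf_le_wild_ratPoint_of_lt_pow T pp hpq hpl ht hpole B x₀ hlt

end Summit.ABC.IUTFork.Conditional

end
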